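import Summits.QuantumFields.YangMills.Theorems.BalabanUVNodesK0AxDoorOfSig8Box
import Summits.QuantumFields.YangMills.Theorems.BalabanUVNodesK0AxJunctionHessBoxD9
import Summits.QuantumFields.YangMills.Theorems.BalabanUVNodesK0AxDressLinkOrbit

/-!
# P3 g91 №16 — THE BOX DOORS' CHART-ROW SUPPLIER `hRows` IS DISCHARGED BY ◇ lens-1's TWO RECEIPTS (C-orb)♭ + TokP9reg♭: K0ᴬ AND THE JUNCTION BODY ON THE BOX ROAD
# WITH NO CHART ROW DISPLAYED — LENS P3 «weaken the target»

LANDING NOTE (porter ▶ PTC-1 g4, 2026-08-31; AUTHORSHIP = ★ P3 g91 «weaken the target», HOME sketch `nodeO-cover/P3-ChartRowsOfOrbit-v1p2.lean` sha16 0c9c8e698616ac42 · 295 l. · 8 thm, no `def`, 0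
sorry (№16 v1.2 = v1.1 ⊕ §5)): landed VERBATIM (only this paragraph added) under P3's basename (`…Theorems/BalabanUVNodesK0AxChartRowsOfOrbit.lean`, ns `…Theorems.K0AxChartRowsOfOrbit`) as
INTENT-64 per ★★★ №571 (1) («ONE filer per leaf: ◆ g38 cut → ▶ PTC-1») and ◆ CRIT-1 g38's cut: «(B) CUT — ★ P3 №16 v1.2 → `…K0AxChartRowsOfOrbit.lean`: GO VERBATIM at v1.2 = v1.1 ⊕ §5 — MY CALL:
KEEP §5; farm rc 0 · 0 warn · 0 sorry, axioms std guarded on all 8 decls, dedup 8∕8 = 0» (nodeO STATUS 2026-08-31T12:14:23Z); imports ✓p820911 `…K0AxDoorOfSig8Box` + ✓p820772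
`…K0AxJunctionHessBoxD9` + ✓p819908 `…K0AxDressLinkOrbit`; `--supports stmt-QuantumFields-27238 --as helper` (NO `--workitem`; kind proof); the author's four bare `#print axioms` lines kept
(tree-precedented).  HONEST (porter): CONDITIONAL theorems ∕ doors over DISPLAYED letters inhabited NOWHERE; nothing of Bałaban asserted, ported, discharged or refuted; K0ᴬ
stmt-QuantumFields-27238 OPEN — NOTHING of it proved; K1ᴬ 27239 ∕ K3ᴬ 27247 OPEN; NODE O 0∕1; COUNT 8∕28 · K 1∕4 UNMOVED; finite 𝕋⁴ at fixed ε — NOT continuum ∕ OS ∕ Clay; the Yang–Mills mass gap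
is NOT proved by any of this.

ym-nodeO-ideate ★ P3 g91 (count-neutral author seat; sketch OFFERED to ◆ CRIT-1 ∕ ▶ PTC-1 — P3 files nothing).  WHAT THIS FILE DOES, exactly.  Every K0ᴬ∕junction door of the BOX road of
record — ✓`record13SepCoPHInhabitedAx_of_sig8LR4Box_antecedents_chartRows` (№12, ✓p820911), ✓`record13SepCoPHInhabitedAx_of_chartRowsBox_cofinalRadii` (№9A, ✓p820563 :315),
✓`cofinalBetaSocketAxBody_of_chartRowsBox_hessBox_negPart` (№10, ✓p820772 :101) — displays the SAME history-free chart-row supplier `hRows`: ONE chart `ιC k n` on the record volumes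
`recordK₀ F Mc k + n` with (ra-1) the equivariant SWAP row against `recordEmbJ`, (ra-3) `C²` at `0` and `ιC k n 0 = 0`, (ra-4) the LINK row `recordGkLocWξ … Finset.univ a l = ∂ιC(0)(δ_l ⊗ bV a)`.
◇ lens-1 g10's (R-a) bridge «move the chart, not the letters» discharges exactly these rows at the LEG-DRESSED chart `ιC♮ k n := recordEmbJDressed F θ k (recordK₀ F Mc k + n) (φ′ k n)`
from TWO displayed receipts — (C-orb)♭ `RootedResponseOrbitAt F θ k (recordK₀ F Mc k + n) a l` for all `k n a l` ([15] (176)–(178): the rooted linearised response lies in the gradient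
orbit of the whole-torus window response) and TokP9reg♭ (the entries of the rooted background field `B ↦ U_{k+1}(W_B)` are `C²` at `B = 0`, [15] Prop. 9) — but only INLINE, inside the
RUN-road assemblies ✓`twoVolExp_dressed_of_cmp` ∕ ✓`twoVolExp_orbit_images` (whose conclusion is the run letter [E]).  The BOX doors never received it.  Here:
§1 ★★`chartRowsBox_of_orbit` — (C-orb)♭ + TokP9reg♭ + `0 < a₀` ⟹ `hRows` IN THE DOORS' EXACT BYTES (`∃ ιC, swap ∧ (C²∕zero ∧ link)`), by ✓`K0AxCtabUniq.dressLink_of_orbit` (φ′ per volume),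
   ✓`PortU8.contDiffAt_recordEmbJ_of` + ✓`contDiffAt_matrix_of_entries` (HypAn from TokP9reg♭), ✓`recordEmbJ_zero_thetaFill`, and DEF-1's dressed rows ✓`eventually_recordChartJ_recordEmbJDressed`
   (ra-1) · ✓`contDiffAt_recordEmbJDressed` + ✓`recordEmbJDressed_zero_thetaFill` (ra-3) · ✓`recordGkLocWξ_univ_eq_fderiv_recordEmbJDressed` (ra-4) — the proof of ✓`twoVolExp_dressed_of_cmp`
   :118–:131 + ✓`twoVolExp_orbit_images` :120–:128 lifted out VERBATIM as a named theorem (history-free: the chart does not read `v`, so ONE discharge serves runs AND boxes);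
§2 ★★★ K0ᴬ BY NAME `record13SepCoPHInhabitedAx_of_sig8LR4Box_antecedents_orbit` — №12's door with `hRows` ↦ [(C-orb)♭ ∧ TokP9reg♭ at every admissible `Mc`, `a₀ > 0`, `ε₂₉ > 0`]:
   **K0ᴬ ⟸ ⁸-on-the-box `Sig8LR4Box` ∧ the JOIN's cofinal antecedents ∧ (C-orb)♭ ∧ TokP9reg♭** — the box road's K0ᴬ residue WITHOUT ANY CHART ROW;
§2′ ★★★ `record13SepCoPHInhabitedAx_of_sig8LR4Box_antecedents_orb` — the SAME door with TokP9reg♭ DROPPED: the JOIN's own antecedent (12) (TokP9-reg: the entries of `recordBgField` are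
   ANALYTIC at `0`, [15] Prop. 9) gives `C²` at the very cube letter `Mc` where №12's proof reads the rows ⇒ **K0ᴬ ⟸ `Sig8LR4Box` ∧ `JoinAntecedentsCofinal` ∧ (C-orb)♭** (box road, three displayed items);
§3 ★ the token-free cofinal-radii door `record13SepCoPHInhabitedAx_of_D1Box_orbit_cofinalRadii` (№9A :315 ∘ §1): K0ᴬ ⟸ D1-box ∧ (C-orb)♭ ∧ TokP9reg♭ ∧ guards at cofinal radii;
§4 ★★ the junction body `cofinalBetaSocketAxBody_of_D1Box_orbit_hessBox_negPart` (№10 :101 ∘ §1): D1-box + (C-orb)♭ + TokP9reg♭ + (V-hess-cont-box) + (L-negpart-box) at ONE radius ⟹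
   `CofinalBetaSocketAxBody F a`; ★ its `hβc`-VERBATIM packaging at cofinally small radii.
§5 ★★ `cofinalBetaSocketAxBody_allRadii_of_sig8LR4Box_antecedents_orb_hess_negPart` — the junction's `hβc` THROUGH THE JOIN: D1-box from `Sig8LR4Box` at the JOIN's `Mc`, the rows by §1 with
   antecedent (12) ⇒ junction residue = K0ᴬ's three items {`Sig8LR4Box`, `JoinAntecedentsCofinal`, (C-orb)♭} + TWO letters {Hessian row, sign letter} (∀ parameters, since ⁸ binds its `γ₀ ε₂₉`); ★ K0ᴬ by name through it.
EDGE CONTENT (LENS-P3 decision table, box road, numbers not adjectives): the «chart rows of ONE ιC» column is DELETED from every box-road residue and replaced by the two receipts ◇ lens-1 g11's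
«rooting is a gradient at first order» files now feed (✓`rootedReceipts_of_bgScheme` ∕ ✓`tokP9reg_of_bgScheme` ∕ ✓`rootedReceipts_of_tokens_chart`, ✓p821443∕✓p821519, from node00-def-Y's
`BgScheme` chart + the tangent socket): K0ᴬ's box-road residue = {`Sig8LR4Box` (⟨27930⟩'s FE half signed on the box), `JoinAntecedentsCofinal`, (C-orb)♭} (§2′; TokP9reg♭ rides inside the JOIN's antecedents); the junction's =
{D1-box, (C-orb)♭, TokP9reg♭, the Hessian-continuity row, ONE sign letter} (§4) or, THROUGH THE JOIN (§5), {`Sig8LR4Box`, `JoinAntecedentsCofinal`, (C-orb)♭, the Hessian-continuity row ∀ parameters, ONE sign letter ∀ parameters}.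
WHAT IT IS NOT.  (C-orb)♭ and TokP9reg♭ are DISPLAYED receipts (OPEN: P0's territory — [15] Prop. 9 ∕ (176)–(178) at the record); `Sig8LR4Box` is the ADOPTED box text of ⟨27930⟩'s FE half,
signed NOWHERE; `JoinAntecedentsCofinal` inhabited NOWHERE; D1-box, the Hessian row and the sign letter are OPEN Bałaban-strength content.  Nothing here discharges any of them.

HONEST FRAMING.  CONDITIONAL doors (kernel-checked implications between DISPLAYED rows; audit `proof.conditional`, credits nothing); NOTHING of Bałaban is asserted, ported, discharged or
refuted; K0ᴬ stmt-QuantumFields-27238 OPEN — NOTHING of it proved; K1ᴬ 27239 ∕ K3ᴬ 27247 ∕ ⟨27930⟩ OPEN; NODE O `B13TermWalkDataOneTorus.ExistsUniformAcrossSmall` NOT inhabited (0∕1);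
COUNT 8∕28 · K 1∕4 UNMOVED; finite `𝕋⁴_{L^K}` at fixed ε — NOT continuum ∕ ℝ⁴ ∕ OS; R4 = the conditional `BalabanLadder.UV` rung only; **the Yang–Mills mass gap (Clay) is NOT proved by any of this.**
No `sorry`, no `def`, no `instance`, no `notation`; standard axioms.

References: T. Bałaban, *Renormalization group approach to lattice gauge field theories. I*, Comm. Math. Phys. 109 (1987) 249–301 [Balaban1987RG1] — Thm 1 p.259, Thm 2 (0.31) p.259,
Thm 3 p.264, (1.7)–(1.10) pp.261–262, (1.18)–(1.22) pp.263–264, (4.8) p.283, (4.15) p.284, (4.35)–(4.37) pp.290–291, (5.10) p.293, (5.38)–(5.44) pp.296–297; T. Bałaban, *The variational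
problem and background fields in renormalization group method for lattice gauge theories*, Comm. Math. Phys. 102 (1985) 277–309 [Balaban1985Variational] — Prop. 9 p.309, (176)–(178)
p.306; T. Bałaban, *Propagators for lattice gauge theories in a background field*, Comm. Math. Phys. 99 (1985) 389–434 [Balaban1984PropagatorsII] — (2.12) p.225, (2.35) p.228.
-/

noncomputable section

open Filter Topology
open scoped BigOperators Matrix.Norms.L2Operator

namespace Summit.QuantumFields.YangMills.Theorems.K0AxChartRowsOfOrbit

open Literature.MathematicalPhysics.QuantumFieldTheory.Balaban1983to89
open Literature.MathematicalPhysics.QuantumFieldTheory.Balaban1983to89.Node00 (betaOfRecord₁₃Ax Stage13Params SU)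
open Literature.MathematicalPhysics.QuantumFieldTheory.Balaban1983to89.T4Continuum (T4Family)
open Literature.MathematicalPhysics.QuantumFieldTheory.Balaban1983to89.B12FormatPlus
open Literature.MathematicalPhysics.QuantumFieldTheory.Balaban1983to89.FlowStep
open Literature.MathematicalPhysics.QuantumFieldTheory.Balaban1983to89.FlowStepRuns
open Summit.QuantumFields.YangMills.Theorems.K0RecordFormatNames
open Summit.QuantumFields.YangMills.Theorems.K0AxMomentRoad
open Summit.QuantumFields.YangMills.Theorems.PortU8 (contDiffAt_recordEmbJ_of contDiffAt_matrix_of_entries recordEmbJ_zero_thetaFill)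
open Summit.QuantumFields.YangMills.Theorems.K0AxCtabUniq (dressLink_of_orbit)
open Summit.QuantumFields.YangMills.Theorems.PortHRecordJoin (JoinAntecedentsCofinal TokP9L4Old)
open Summit.QuantumFields.YangMills.Theorems.BalabanUVNodesPortS1 (Sig8LR4Box)

/-! ## §1  The doors' chart-row supplier `hRows` from (C-orb)♭ + TokP9reg♭ at the leg-dressed chart -/

/-- ★★ **`chartRowsBox_of_orbit` — THE BOX DOORS' `hRows` FROM THE TWO RECEIPTS.**  At `θ := thetaFill F a₀ ε₂₉`, `0 < a₀`, for any cube letter `Mc`: (C-orb)♭ (every rooted linearised response on the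
record volumes lies in the gradient orbit of the whole-torus window response) + TokP9reg♭ (the rooted background field's entries are `C²` at `B = 0`) give ONE chart `ιC` — the leg-dressed
`ιC k n := recordEmbJDressed F θ k (recordK₀ F Mc k + n) (φ′ k n)` with `φ′ k n` from ✓`dressLink_of_orbit` — carrying the swap row against `recordEmbJ`, the `C²`∕zero rows and the link row against
`recordGkLocWξ … Finset.univ`, IN THE EXACT BYTES the box doors display (✓`record13SepCoPHInhabitedAx_of_sig8LR4Box_antecedents_chartRows`'s `hRows`).  History-free.  CONDITIONAL on the two receipts
(OPEN, P0's territory); asserts nothing of Bałaban; K0ᴬ OPEN. [cite: Balaban1985Variational, (176)–(178) p.306, Prop. 9 p.309; Balaban1984PropagatorsII, (2.35) p.228; Balaban1987RG1, (1.7)–(1.10) pp.261–262, (4.8) p.283, (4.15) p.284, (4.35) p.290] -/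
theorem chartRowsBox_of_orbit (F : T4Family) (Mc : ℕ) (a₀ ε₂₉ : ℝ) (ha₀ : 0 < a₀)
    (horb : letI θ := thetaFill F a₀ ε₂₉; letI := θ.instVβ₁; letI := θ.instVβ₂; letI := θ.instιβ;
      (∀ (k n : ℕ) (a : θ.ιβ) (l : RespLabel F k (recordK₀ F Mc k + n)), RootedResponseOrbitAt F θ k (recordK₀ F Mc k + n) a l))
    (hd2 : letI θ := thetaFill F a₀ ε₂₉; letI := θ.instVβ₁; letI := θ.instVβ₂; letI := θ.instιβ;
      (∀ k n : ℕ, ContDiffAt ℝ 2 (fun B : recordW F a₀ ε₂₉ k (recordK₀ F Mc k + n) => fun (b : PBond (F.P (recordK₀ F Mc k + n)) 0) (i i' : Fin 2) =>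
          ((recordBgField F θ k (recordK₀ F Mc k + n) B b : SU 2) : Matrix (Fin 2) (Fin 2) ℂ) i i') 0)) :
    letI θ := thetaFill F a₀ ε₂₉; letI := θ.instVβ₁; letI := θ.instVβ₂; letI := θ.instιβ;
    ∃ ιC : (k n : ℕ) → recordW F a₀ ε₂₉ k (recordK₀ F Mc k + n) → (Fin (recordChartDimJ F (recordK₀ F Mc k + n)) → ℂ),
        (∀ (k n : ℕ), ∀ᶠ B in 𝓝 (0 : recordW F a₀ ε₂₉ k (recordK₀ F Mc k + n)), ∀ X : (recordDomSys F Mc k (recordK₀ F Mc k + n)).Dom,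
            ∃ g : recordGaugeGrp F (recordK₀ F Mc k + n), ∀ i ∈ recordCoords F Mc k (recordK₀ F Mc k + n) X,
              recordChartJ F Mc k (recordK₀ F Mc k + n) X (ιC k n B) i =
                recordAct F (recordK₀ F Mc k + n) g (recordChartJ F Mc k (recordK₀ F Mc k + n) X (recordEmbJ F θ k (recordK₀ F Mc k + n) B)) i) ∧
        (∀ k : ℕ, (∀ n : ℕ, ContDiffAt ℝ 2 (ιC k n) 0 ∧ ιC k n 0 = 0) ∧
            ∀ (n : ℕ) (a : θ.ιβ) (l : RespLabel F k (recordK₀ F Mc k + n)),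
              recordGkLocWξ F θ k (recordK₀ F Mc k + n) Finset.univ a l = fun i => fderiv ℝ (ιC k n) 0 (Pi.single l.1 (Pi.single l.2 (θ.bV a))) i) := by
  letI θ := thetaFill F a₀ ε₂₉; letI := θ.instVβ₁; letI := θ.instVβ₂; letI := θ.instιβ
  -- the standing range at the record volumes `K := recordK₀ F Mc k + n`
  have hk : ∀ k n : ℕ, k + 1 ≤ (F.P (recordK₀ F Mc k + n)).m + (F.P (recordK₀ F Mc k + n)).K := fun k n => by
    simp only [T4Family.P_m, T4Family.P_K, recordK₀]
    omega
  -- the dressing potentials, volume by volume, from (C-orb)♭ + TokP9reg♭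
  choose φ' hφ' using fun k n => dressLink_of_orbit F a₀ ε₂₉ ha₀ k (recordK₀ F Mc k + n) (hk k n) (hd2 k n) (horb k n)
  -- HypAn for `recordEmbJ` from the C² entries, and its value at `0`
  have hAn : ∀ k n : ℕ, ContDiffAt ℝ 2 (recordEmbJ F θ k (recordK₀ F Mc k + n)) 0 := fun k n =>
    contDiffAt_recordEmbJ_of F θ k (recordK₀ F Mc k + n) (hk k n) ha₀ (contDiffAt_matrix_of_entries (hd2 k n))
  have hz : ∀ k n : ℕ, recordEmbJ F θ k (recordK₀ F Mc k + n) 0 = 0 := fun k n => recordEmbJ_zero_thetaFill F a₀ ε₂₉ ha₀ Mc k n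
  refine ⟨fun k n => recordEmbJDressed F θ k (recordK₀ F Mc k + n) (φ' k n), fun k n => ?_, fun k => ⟨fun n => ⟨?_, ?_⟩, fun n a l => ?_⟩⟩
  · exact eventually_recordChartJ_recordEmbJDressed F θ Mc k (recordK₀ F Mc k + n) (φ' k n) (hAn k n).continuousAt (hz k n)
  · exact contDiffAt_recordEmbJDressed F θ k (recordK₀ F Mc k + n) (φ' k n) (hAn k n) (hz k n)
  · exact recordEmbJDressed_zero_thetaFill F a₀ ε₂₉ ha₀ Mc k n (φ' k n)
  · exact recordGkLocWξ_univ_eq_fderiv_recordEmbJDressed F θ k (recordK₀ F Mc k + n) (φ' k n) (hφ' k n) a l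
      ((hAn k n).differentiableAt (by norm_num)) (hz k n)

/-! ## §2  ★★★ K0ᴬ BY NAME: №12's box door with the chart rows replaced by the two receipts -/

/-- ★★★ **K0ᴬ BY NAME FROM ⁸-ON-THE-BOX + THE JOIN's COFINAL ANTECEDENTS + (C-orb)♭ + TokP9reg♭ — NO CHART ROW DISPLAYED**: `(∀ F, Sig8LR4Box F)` ∧ `(∀ F, JoinAntecedentsCofinal Tok F)` with
`Tok ⟹ TokP9L4Old` ∧ [for every admissible `Mc`, `a₀ > 0`, `ε₂₉ > 0`: (C-orb)♭ ∧ TokP9reg♭ at `thetaFill F a₀ ε₂₉` on the record volumes] ⟹ `Theses.BalabanUVNodes.Record13SepCoPHInhabitedAx` —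
✓`record13SepCoPHInhabitedAx_of_sig8LR4Box_antecedents_chartRows` with its `hRows` produced by §1.  CONDITIONAL door; every hypothesis OPEN (`Sig8LR4Box` = ADOPTED text of ⟨27930⟩'s FE half, signed
nowhere; `JoinAntecedentsCofinal` inhabited nowhere; the receipts = P0's territory); K0ᴬ 27238 OPEN; the Yang–Mills mass gap is NOT proved.
[cite: Balaban1987RG1, Thm 1 p.259, Thm 3 p.264, (1.18)–(1.22) pp.263–264, (4.35)–(4.37) pp.290–291, (5.10) p.293; Balaban1985Variational, Thm 1 p.279, Prop. 9 p.309, (176)–(178) p.306; Balaban1984PropagatorsII, (2.35) p.228] -/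
theorem record13SepCoPHInhabitedAx_of_sig8LR4Box_antecedents_orbit (Tok : T4Family → ℕ → ℝ → Prop)
    (hBr : ∀ (F : T4Family) (Mc : ℕ) (a₀ : ℝ), Tok F Mc a₀ → TokP9L4Old F Mc a₀)
    (h8 : ∀ F, Sig8LR4Box F) (hA : ∀ F, JoinAntecedentsCofinal Tok F)
    (hOrb : ∀ (F : T4Family) (Mc : ℕ) (a₀ ε₂₉ : ℝ), McGuard F Mc → 0 < a₀ → 0 < ε₂₉ →
      letI θ := thetaFill F a₀ ε₂₉; letI := θ.instVβ₁; letI := θ.instVβ₂; letI := θ.instιβ;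
      (∀ (k n : ℕ) (a : θ.ιβ) (l : RespLabel F k (recordK₀ F Mc k + n)), RootedResponseOrbitAt F θ k (recordK₀ F Mc k + n) a l) ∧
      (∀ k n : ℕ, ContDiffAt ℝ 2 (fun B : recordW F a₀ ε₂₉ k (recordK₀ F Mc k + n) => fun (b : PBond (F.P (recordK₀ F Mc k + n)) 0) (i i' : Fin 2) =>
          ((recordBgField F θ k (recordK₀ F Mc k + n) B b : SU 2) : Matrix (Fin 2) (Fin 2) ℂ) i i') 0)) :
    Summit.QuantumFields.YangMills.Theses.BalabanUVNodes.Record13SepCoPHInhabitedAx :=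
  record13SepCoPHInhabitedAx_of_sig8LR4Box_antecedents_chartRows Tok hBr h8 hA fun F Mc a₀ ε₂₉ hMc ha₀ hε =>
    chartRowsBox_of_orbit F Mc a₀ ε₂₉ ha₀ (hOrb F Mc a₀ ε₂₉ hMc ha₀ hε).1 (hOrb F Mc a₀ ε₂₉ hMc ha₀ hε).2

/-- ★★★ **K0ᴬ BY NAME FROM ⁸-ON-THE-BOX + THE JOIN's COFINAL ANTECEDENTS + (C-orb)♭ ALONE — TokP9reg♭ IS REDUNDANT ON THIS DOOR.**  The JOIN's displayed antecedents
`JoinAntecedents Tok F Mc …` already CARRY, as their twelfth conjunct (TokP9-reg, [15] Prop. 9's analyticity AT THE RECORD), `AnalyticAt ℝ (B ↦ entries of recordBgField F θ k (recordK₀ F Mc k + n) B) 0`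
for every `k n` and every `ε₂₉ > 0` — at exactly the cube letter `Mc` at which №12's proof consumes the chart rows; analyticity ⟹ `C²` (`AnalyticAt.contDiffAt`), so §1's second receipt is
supplied by the JOIN itself and only (C-orb)♭ stays displayed: `(∀ F, Sig8LR4Box F)` ∧ `(∀ F, JoinAntecedentsCofinal Tok F)` (`Tok ⟹ TokP9L4Old`) ∧ [for every admissible `Mc`, `a₀ > 0`,
`ε₂₉ > 0`: (C-orb)♭ at `thetaFill F a₀ ε₂₉` on the record volumes] ⟹ `Theses.BalabanUVNodes.Record13SepCoPHInhabitedAx`.  Proof = ✓`record13SepCoPHInhabitedAx_of_sig8LR4Box_antecedents_chartRows`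
:73–:82 VERBATIM with its line :79 `hRows F Mc a ε₂₉ hG0 ha hε` replaced by §1 fed with `(hBg k n ε₂₉ hε).contDiffAt`.  CONDITIONAL door; every hypothesis OPEN (`Sig8LR4Box` = ADOPTED text of
⟨27930⟩'s FE half, signed nowhere; `JoinAntecedentsCofinal` inhabited nowhere; (C-orb)♭ = P0's territory); K0ᴬ 27238 OPEN; the Yang–Mills mass gap is NOT proved.
[cite: Balaban1987RG1, Thm 1 p.259, Thm 3 p.264, (1.18)–(1.22) pp.263–264, (4.35)–(4.37) pp.290–291, (5.10) p.293; Balaban1985Variational, Thm 1 p.279, Prop. 9 p.309, (176)–(178) p.306; Balaban1984PropagatorsII, (2.35) p.228] -/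
theorem record13SepCoPHInhabitedAx_of_sig8LR4Box_antecedents_orb (Tok : T4Family → ℕ → ℝ → Prop)
    (hBr : ∀ (F : T4Family) (Mc : ℕ) (a₀ : ℝ), Tok F Mc a₀ → TokP9L4Old F Mc a₀)
    (h8 : ∀ F, Sig8LR4Box F) (hA : ∀ F, JoinAntecedentsCofinal Tok F)
    (hOrb : ∀ (F : T4Family) (Mc : ℕ) (a₀ ε₂₉ : ℝ), McGuard F Mc → 0 < a₀ → 0 < ε₂₉ →
      letI θ := thetaFill F a₀ ε₂₉; letI := θ.instVβ₁; letI := θ.instVβ₂; letI := θ.instιβ;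
      (∀ (k n : ℕ) (a : θ.ιβ) (l : RespLabel F k (recordK₀ F Mc k + n)), RootedResponseOrbitAt F θ k (recordK₀ F Mc k + n) a l)) :
    Summit.QuantumFields.YangMills.Theses.BalabanUVNodes.Record13SepCoPHInhabitedAx := by
  refine record13SepCoPHInhabitedAx_of_chartRowsBox_cofinalRadii fun F a ha => ?_
  obtain ⟨Mth, h8F⟩ := h8 F
  obtain ⟨Mc, hMc, j, c, c₀, c₁, B₃, B₃', a₁, hAnt⟩ := hA F Mth a ha
  obtain ⟨hG0, hc, hc₀, hc₁, hB₃, hB₃', ha₀, ha₁, hThm, hGauge, hUk, hBg, hP9⟩ := hAnt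
  obtain ⟨γ₀, ε₂₉, E₀, κ, α₀, α₁, hγ₀, hε, hE₀, hκ, hα₀, hα₁, hD⟩ :=
    h8F Mc hMc j c c₀ c₁ B₃ B₃' a a₁ hG0 hc hc₀ hc₁ hB₃ hB₃' ha₀ ha₁ hThm hGauge hUk hBg (hBr F Mc a hP9)
  -- the chart rows at the JOIN's own cube letter: (C-orb)♭ displayed, TokP9reg♭ from the JOIN's antecedent (12) (analytic ⟹ C²)
  letI θ := thetaFill F a ε₂₉; letI := θ.instVβ₁; letI := θ.instVβ₂; letI := θ.instιβ
  obtain ⟨ιC, hsw, h9⟩ := chartRowsBox_of_orbit F Mc a ε₂₉ ha (hOrb F Mc a ε₂₉ hG0 ha hε) fun k n => (hBg k n ε₂₉ hε).contDiffAt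
  refine ⟨a, ha, le_rfl, min γ₀ (1 / 2), ε₂₉, E₀, κ, 4 * (Mc : ℝ), α₀, α₁, Mc, lt_min hγ₀ (by norm_num), min_le_right _ _, hε, hE₀, hκ,
    hα₀, hα₁, hG0, le_rfl, ιC, fun k v hv => hD k v ?_, hsw, h9⟩
  exact mem_box.mpr fun i => ⟨(mem_box.mp hv i).1, (mem_box.mp hv i).2.trans (min_le_left _ _)⟩

/-! ## §3  ★ The token-free cofinal-radii door: K0ᴬ ⟸ D1-box ∧ (C-orb)♭ ∧ TokP9reg♭ ∧ guards -/

/-- ★ **THE COFINAL-RADII K0ᴬ DOOR WITH THE RECEIPTS IN PLACE OF THE CHART ROWS** (✓`record13SepCoPHInhabitedAx_of_chartRowsBox_cofinalRadii` ∘ §1): for every family and cofinally small radii,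
guards ∧ D1 AT EVERY BOX HISTORY (⁸'s mould at `recordEmbJ`) ∧ (C-orb)♭ ∧ TokP9reg♭ ⟹ K0ᴬ BY NAME.  CONDITIONAL door; every conjunct of `H` OPEN; K0ᴬ OPEN; the Yang–Mills mass gap is NOT proved.
[cite: Balaban1987RG1, Thm 1 p.259, Thm 3 p.264, (1.18)–(1.22) pp.263–264, (4.35)–(4.37) pp.290–291, (5.10) p.293, (5.42) p.297; Balaban1985Variational, Prop. 9 p.309, (176)–(178) p.306] -/
theorem record13SepCoPHInhabitedAx_of_D1Box_orbit_cofinalRadii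
    (H : ∀ F : T4Family, ∀ a : ℝ, 0 < a → ∃ a₀ : ℝ, 0 < a₀ ∧ a₀ ≤ a ∧ ∃ (γ₀ ε₂₉ E₀ κ Mg α₀ α₁ : ℝ) (Mc : ℕ),
      0 < γ₀ ∧ γ₀ ≤ 1 / 2 ∧ 0 < ε₂₉ ∧ 0 ≤ E₀ ∧ 4 * B12TreeDecay.kappa₀ (4 * 2 ^ 4) (2 * 4) ≤ κ ∧ 0 < α₀ ∧ 0 < α₁ ∧ McGuard F Mc ∧ 4 * (Mc : ℝ) ≤ Mg ∧
      (letI θ := thetaFill F a₀ ε₂₉; letI := θ.instVβ₁; letI := θ.instVβ₂; letI := θ.instιβ;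
        (∀ (k : ℕ) (v : Fin (k + 1) → ℝ), v ∈ FlowStep.Box γ₀ k →
          B12FormatPlus.FormatPlusG (fun n => recordDomSys F Mc k (recordK₀ F Mc k + n)) (fun n => recordBondCount F (recordK₀ F Mc k + n))
            (fun n => recordAct F (recordK₀ F Mc k + n)) (fun n => recordUc F Mc k α₀ α₁ (recordK₀ F Mc k + n))
            (fun n => recordCoords F Mc k (recordK₀ F Mc k + n)) (fun n => recordChartDimJ F (recordK₀ F Mc k + n))
            (fun n => recordChartJ F Mc k (recordK₀ F Mc k + n)) (fun n => recordΦfAx F a₀ ε₂₉ k v (recordK₀ F Mc k + n))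
            (fun n => recordEmbJ F θ k (recordK₀ F Mc k + n)) (fun n => recordWrapCtr F Mc k (recordK₀ F Mc k + n))
            (fun n => recordDomEmbCtr F Mc k (recordK₀ F Mc k + n)) (fun n _ => recordCoordProjCtr F (recordK₀ F Mc k + n)) E₀ κ) ∧
        (∀ (k n : ℕ) (a : θ.ιβ) (l : RespLabel F k (recordK₀ F Mc k + n)), RootedResponseOrbitAt F θ k (recordK₀ F Mc k + n) a l) ∧
        (∀ k n : ℕ, ContDiffAt ℝ 2 (fun B : recordW F a₀ ε₂₉ k (recordK₀ F Mc k + n) => fun (b : PBond (F.P (recordK₀ F Mc k + n)) 0) (i i' : Fin 2) =>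
          ((recordBgField F θ k (recordK₀ F Mc k + n) B b : SU 2) : Matrix (Fin 2) (Fin 2) ℂ) i i') 0))) :
    Summit.QuantumFields.YangMills.Theses.BalabanUVNodes.Record13SepCoPHInhabitedAx := by
  refine record13SepCoPHInhabitedAx_of_chartRowsBox_cofinalRadii fun F a ha => ?_
  obtain ⟨a₀, ha₀, hle, γ₀, ε₂₉, E₀, κ, Mg, α₀, α₁, Mc, hγ₀, hγh, hε, hE₀, hκ₀, hα₀, hα₁, hMc, hMg4, h8, horb, hd2⟩ := H F a ha
  obtain ⟨ιC, hsw, h9⟩ := chartRowsBox_of_orbit F Mc a₀ ε₂₉ ha₀ horb hd2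
  exact ⟨a₀, ha₀, hle, γ₀, ε₂₉, E₀, κ, Mg, α₀, α₁, Mc, hγ₀, hγh, hε, hE₀, hκ₀, hα₀, hα₁, hMc, hMg4, ιC, h8, hsw, h9⟩

/-! ## §4  ★★ The junction body on the box road with the receipts in place of the chart rows -/

/-- ★★ **THE JUNCTION SOCKET BODY FROM D1-box + (C-orb)♭ + TokP9reg♭ + (V-hess-cont-box) + (L-negpart-box)** (✓`cofinalBetaSocketAxBody_of_chartRowsBox_hessBox_negPart` ∘ §1): at ONE radius
`0 < a₀ ≤ a`, level `0 < γ₀ ≤ ½`, the displayed rows inhabit `CofinalBetaSocketAxBody F a` — NO chart row, NO token, NO kernel-level continuity letter.  CONDITIONAL; every row OPEN Bałaban-strength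
content (the receipts: P0's territory); the junction's consumer, K0ᴬ 27238 and K1ᴬ 27239 remain OPEN; the Yang–Mills mass gap is NOT proved.
[cite: Balaban1987RG1, Thm 1 p.259, Thm 2 (0.31) p.259, Thm 3 p.264, (1.18)–(1.22) pp.263–264, p.266, (5.10) p.293, (5.38)–(5.44) pp.296–297; Balaban1985Variational, Prop. 9 p.309, (176)–(178) p.306] -/
theorem cofinalBetaSocketAxBody_of_D1Box_orbit_hessBox_negPart {E₀ κ Mg a : ℝ} {e : ℕ → ℝ}
    (hE₀ : 0 ≤ E₀) (hκ₀ : 4 * B12TreeDecay.kappa₀ (4 * 2 ^ 4) (2 * 4) ≤ κ) :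
    ∀ (F : T4Family) (a₀ ε₂₉ γ₀ α₀ α₁ : ℝ), 0 < a₀ → a₀ ≤ a → 0 < γ₀ → γ₀ ≤ 1 / 2 → 0 < ε₂₉ → 0 < α₀ → 0 < α₁ →
      ∀ Mc : ℕ, McGuard F Mc → 4 * (Mc : ℝ) ≤ Mg →
      letI θ := thetaFill F a₀ ε₂₉; letI := θ.instVβ₁; letI := θ.instVβ₂; letI := θ.instιβ;
        (∀ (k : ℕ) (v : Fin (k + 1) → ℝ), v ∈ FlowStep.Box γ₀ k →
          B12FormatPlus.FormatPlusG (fun n => recordDomSys F Mc k (recordK₀ F Mc k + n)) (fun n => recordBondCount F (recordK₀ F Mc k + n))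
            (fun n => recordAct F (recordK₀ F Mc k + n)) (fun n => recordUc F Mc k α₀ α₁ (recordK₀ F Mc k + n))
            (fun n => recordCoords F Mc k (recordK₀ F Mc k + n)) (fun n => recordChartDimJ F (recordK₀ F Mc k + n))
            (fun n => recordChartJ F Mc k (recordK₀ F Mc k + n)) (fun n => recordΦfAx F a₀ ε₂₉ k v (recordK₀ F Mc k + n))
            (fun n => recordEmbJ F θ k (recordK₀ F Mc k + n)) (fun n => recordWrapCtr F Mc k (recordK₀ F Mc k + n))
            (fun n => recordDomEmbCtr F Mc k (recordK₀ F Mc k + n)) (fun n _ => recordCoordProjCtr F (recordK₀ F Mc k + n)) E₀ κ) →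
      (∀ (k n : ℕ) (a : θ.ιβ) (l : RespLabel F k (recordK₀ F Mc k + n)), RootedResponseOrbitAt F θ k (recordK₀ F Mc k + n) a l) →
      (∀ k n : ℕ, ContDiffAt ℝ 2 (fun B : recordW F a₀ ε₂₉ k (recordK₀ F Mc k + n) => fun (b : PBond (F.P (recordK₀ F Mc k + n)) 0) (i i' : Fin 2) =>
          ((recordBgField F θ k (recordK₀ F Mc k + n) B b : SU 2) : Matrix (Fin 2) (Fin 2) ℂ) i i') 0) →
      (∀ k K : ℕ, ContinuousOn (fun v : Fin (k + 1) → ℝ => fderiv ℝ (fderiv ℝ (B12PolarizationTensor120.expChart (recordTermsAx F a₀ ε₂₉ k v K) θ.ρ8)) 0) (FlowStep.Box γ₀ k)) →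
      RecordPlimMomentNegPartOnBoxAx F a₀ ε₂₉ γ₀ e → CofinalBetaSocketAxBody F a := by
  intro F a₀ ε₂₉ γ₀ α₀ α₁ ha₀ hle hγ₀ hγh hε hα₀ hα₁ Mc hMc hMg4 h8 horb hd2 hH hneg
  obtain ⟨ιC, hsw, h9⟩ := chartRowsBox_of_orbit F Mc a₀ ε₂₉ ha₀ horb hd2
  exact cofinalBetaSocketAxBody_of_chartRowsBox_hessBox_negPart hE₀ hκ₀ F a₀ ε₂₉ γ₀ α₀ α₁ ha₀ hle hγ₀ hγh hε hα₀ hα₁ Mc hMc hMg4 ιC h8 hsw h9 hH hneg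

/-- ★ **THE JUNCTION's BINDER `hβc` VERBATIM — `∀ F a, 0 < a → CofinalBetaSocketAxBody F a` — FROM D1-box + (C-orb)♭ + TokP9reg♭ + THE HESSIAN ROW + THE SIGN LETTER AT COFINALLY SMALL RADII.**
CONDITIONAL door: every conjunct of `H` is OPEN content; the junction's consumer, K0ᴬ, K1ᴬ, K3ᴬ remain OPEN; NODE O 0∕1; the Yang–Mills mass gap is NOT proved.
[cite: Balaban1987RG1, Thm 1 p.259, Thm 2 (0.31) p.259, Thm 3 p.264, (1.18)–(1.22) pp.263–264, p.266, (5.10) p.293, (5.38)–(5.44) pp.296–297; Balaban1985Variational, Prop. 9 p.309, (176)–(178) p.306] -/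
theorem cofinalBetaSocketAxBody_allRadii_of_D1Box_orbit_hessBox_negPart_cofinalRadii
    (H : ∀ F : T4Family, ∀ a : ℝ, 0 < a → ∃ a₀ : ℝ, 0 < a₀ ∧ a₀ ≤ a ∧ ∃ (γ₀ ε₂₉ E₀ κ Mg α₀ α₁ : ℝ) (Mc : ℕ) (e : ℕ → ℝ),
      0 < γ₀ ∧ γ₀ ≤ 1 / 2 ∧ 0 < ε₂₉ ∧ 0 ≤ E₀ ∧ 4 * B12TreeDecay.kappa₀ (4 * 2 ^ 4) (2 * 4) ≤ κ ∧ 0 < α₀ ∧ 0 < α₁ ∧ McGuard F Mc ∧ 4 * (Mc : ℝ) ≤ Mg ∧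
      RecordPlimMomentNegPartOnBoxAx F a₀ ε₂₉ γ₀ e ∧
      (letI θ := thetaFill F a₀ ε₂₉; letI := θ.instVβ₁; letI := θ.instVβ₂; letI := θ.instιβ;
        (∀ k K : ℕ, ContinuousOn (fun v : Fin (k + 1) → ℝ => fderiv ℝ (fderiv ℝ (B12PolarizationTensor120.expChart (recordTermsAx F a₀ ε₂₉ k v K) θ.ρ8)) 0) (FlowStep.Box γ₀ k)) ∧
        (∀ (k : ℕ) (v : Fin (k + 1) → ℝ), v ∈ FlowStep.Box γ₀ k →
          B12FormatPlus.FormatPlusG (fun n => recordDomSys F Mc k (recordK₀ F Mc k + n)) (fun n => recordBondCount F (recordK₀ F Mc k + n))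
            (fun n => recordAct F (recordK₀ F Mc k + n)) (fun n => recordUc F Mc k α₀ α₁ (recordK₀ F Mc k + n))
            (fun n => recordCoords F Mc k (recordK₀ F Mc k + n)) (fun n => recordChartDimJ F (recordK₀ F Mc k + n))
            (fun n => recordChartJ F Mc k (recordK₀ F Mc k + n)) (fun n => recordΦfAx F a₀ ε₂₉ k v (recordK₀ F Mc k + n))
            (fun n => recordEmbJ F θ k (recordK₀ F Mc k + n)) (fun n => recordWrapCtr F Mc k (recordK₀ F Mc k + n))
            (fun n => recordDomEmbCtr F Mc k (recordK₀ F Mc k + n)) (fun n _ => recordCoordProjCtr F (recordK₀ F Mc k + n)) E₀ κ) ∧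
        (∀ (k n : ℕ) (a : θ.ιβ) (l : RespLabel F k (recordK₀ F Mc k + n)), RootedResponseOrbitAt F θ k (recordK₀ F Mc k + n) a l) ∧
        (∀ k n : ℕ, ContDiffAt ℝ 2 (fun B : recordW F a₀ ε₂₉ k (recordK₀ F Mc k + n) => fun (b : PBond (F.P (recordK₀ F Mc k + n)) 0) (i i' : Fin 2) =>
          ((recordBgField F θ k (recordK₀ F Mc k + n) B b : SU 2) : Matrix (Fin 2) (Fin 2) ℂ) i i') 0))) :
    ∀ F : T4Family, ∀ a : ℝ, 0 < a → CofinalBetaSocketAxBody F a := by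
  intro F a ha
  obtain ⟨a₀, ha₀, hle, γ₀, ε₂₉, E₀, κ, Mg, α₀, α₁, Mc, e, hγ₀, hγh, hε, hE₀, hκ₀, hα₀, hα₁, hMc, hMg4, hneg, hH, h8, horb, hd2⟩ := H F a ha
  exact cofinalBetaSocketAxBody_of_D1Box_orbit_hessBox_negPart hE₀ hκ₀ F a₀ ε₂₉ γ₀ α₀ α₁ ha₀ hle hγ₀ hγh hε hα₀ hα₁ Mc hMc hMg4 h8 horb hd2 hH hneg

/-! ## §5  ★★ The junction body THROUGH THE JOIN: D1-box from ⁸-on-the-box, TokP9reg♭ from antecedent (12) — the junction keyed to K0ᴬ's three items + two letters -/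

/-- ★★ **THE JUNCTION's BINDER `hβc` FROM ⁸-ON-THE-BOX + THE JOIN's COFINAL ANTECEDENTS + (C-orb)♭ + THE HESSIAN ROW + THE SIGN LETTER — D1-box AND THE CHART ROWS AND TokP9reg♭ ALL OFF THE DISPLAY.**
For every family and radius `a > 0`: ⁸'s box edition `Sig8LR4Box F` at the JOIN's cube letter `Mc` (from `JoinAntecedentsCofinal Tok F`, `Tok ⟹ TokP9L4Old`) yields D1 at every box history of SOME
level `γ₀` and (2.9) parameter `ε₂₉` (with `E₀ ≥ 0`, `κ ≥ 4κ₀`, `α₀ α₁ > 0`); §1 at that `Mc` yields the chart rows from (C-orb)♭ and the JOIN's antecedent (12); so, GIVEN the Hessian-continuity row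
(V-hess-cont-box) and ONE sign letter (L-negpart-box) AT EVERY `a₀ ε₂₉ > 0`, `0 < γ₀ ≤ ½` (universal in the parameters because ⁸'s `γ₀ ε₂₉` are bound inside its conclusion), ✓№10
`cofinalBetaSocketAxBody_of_chartRowsBox_hessBox_negPart` at level `min γ₀ ½`, `Mg := 4·Mc`, radius `a₀ := a` inhabits `CofinalBetaSocketAxBody F a`.  NET (LENS P3): the junction's displayed
residue becomes K0ᴬ's three items {`Sig8LR4Box`, `JoinAntecedentsCofinal`, (C-orb)♭} + TWO letters {Hessian row, sign letter} (∀ parameters).  CONDITIONAL; every hypothesis OPEN (⁸'s box text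
signed nowhere; the JOIN's antecedents inhabited nowhere; (C-orb)♭ = P0's territory; the two letters = Bałaban-strength [I] §1∕§5 content + AF sign); the junction's consumer, K0ᴬ 27238, K1ᴬ 27239
remain OPEN; NODE O 0∕1; the Yang–Mills mass gap is NOT proved.
[cite: Balaban1987RG1, Thm 1 p.259, Thm 2 (0.31) p.259, Thm 3 p.264, (1.18)–(1.22) pp.263–264, p.266, (4.35)–(4.37) pp.290–291, (5.10) p.293, (5.38)–(5.44) pp.296–297; Balaban1985Variational, Thm 1 p.279, Prop. 9 p.309, (176)–(178) p.306] -/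
theorem cofinalBetaSocketAxBody_allRadii_of_sig8LR4Box_antecedents_orb_hess_negPart (Tok : T4Family → ℕ → ℝ → Prop)
    (hBr : ∀ (F : T4Family) (Mc : ℕ) (a₀ : ℝ), Tok F Mc a₀ → TokP9L4Old F Mc a₀)
    (h8 : ∀ F, Sig8LR4Box F) (hA : ∀ F, JoinAntecedentsCofinal Tok F)
    (hOrb : ∀ (F : T4Family) (Mc : ℕ) (a₀ ε₂₉ : ℝ), McGuard F Mc → 0 < a₀ → 0 < ε₂₉ →
      letI θ := thetaFill F a₀ ε₂₉; letI := θ.instVβ₁; letI := θ.instVβ₂; letI := θ.instιβ;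
      (∀ (k n : ℕ) (a : θ.ιβ) (l : RespLabel F k (recordK₀ F Mc k + n)), RootedResponseOrbitAt F θ k (recordK₀ F Mc k + n) a l))
    (hHess : ∀ (F : T4Family) (a₀ ε₂₉ γ₀ : ℝ), 0 < a₀ → 0 < ε₂₉ → 0 < γ₀ → γ₀ ≤ 1 / 2 →
      letI θ := thetaFill F a₀ ε₂₉; letI := θ.instVβ₁; letI := θ.instVβ₂; letI := θ.instιβ;
      (∀ k K : ℕ, ContinuousOn (fun v : Fin (k + 1) → ℝ => fderiv ℝ (fderiv ℝ (B12PolarizationTensor120.expChart (recordTermsAx F a₀ ε₂₉ k v K) θ.ρ8)) 0) (FlowStep.Box γ₀ k)))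
    (hNeg : ∀ (F : T4Family) (a₀ ε₂₉ γ₀ : ℝ), 0 < a₀ → 0 < ε₂₉ → 0 < γ₀ → γ₀ ≤ 1 / 2 →
      ∃ e : ℕ → ℝ, RecordPlimMomentNegPartOnBoxAx F a₀ ε₂₉ γ₀ e) :
    ∀ F : T4Family, ∀ a : ℝ, 0 < a → CofinalBetaSocketAxBody F a := by
  intro F a ha
  obtain ⟨Mth, h8F⟩ := h8 F
  obtain ⟨Mc, hMc, j, c, c₀, c₁, B₃, B₃', a₁, hAnt⟩ := hA F Mth a ha
  obtain ⟨hG0, hc, hc₀, hc₁, hB₃, hB₃', ha₀, ha₁, hThm, hGauge, hUk, hBg, hP9⟩ := hAnt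
  obtain ⟨γ₀, ε₂₉, E₀, κ, α₀, α₁, hγ₀, hε, hE₀, hκ, hα₀, hα₁, hD⟩ :=
    h8F Mc hMc j c c₀ c₁ B₃ B₃' a a₁ hG0 hc hc₀ hc₁ hB₃ hB₃' ha₀ ha₁ hThm hGauge hUk hBg (hBr F Mc a hP9)
  letI θ := thetaFill F a ε₂₉; letI := θ.instVβ₁; letI := θ.instVβ₂; letI := θ.instιβ
  -- chart rows at the JOIN's cube letter: (C-orb)♭ displayed, TokP9reg♭ = antecedent (12)
  obtain ⟨ιC, hsw, h9⟩ := chartRowsBox_of_orbit F Mc a ε₂₉ ha (hOrb F Mc a ε₂₉ hG0 ha hε) fun k n => (hBg k n ε₂₉ hε).contDiffAt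
  have hγ₁ : 0 < min γ₀ (1 / 2) := lt_min hγ₀ (by norm_num)
  have hγh : min γ₀ (1 / 2) ≤ 1 / 2 := min_le_right _ _
  obtain ⟨e, hneg⟩ := hNeg F a ε₂₉ (min γ₀ (1 / 2)) ha hε hγ₁ hγh
  refine cofinalBetaSocketAxBody_of_chartRowsBox_hessBox_negPart (Mg := 4 * (Mc : ℝ)) hE₀ hκ F a ε₂₉ (min γ₀ (1 / 2)) α₀ α₁ ha le_rfl hγ₁ hγh hε
    hα₀ hα₁ Mc hG0 le_rfl ιC (fun k v hv => hD k v ?_) hsw h9 (hHess F a ε₂₉ (min γ₀ (1 / 2)) ha hε hγ₁ hγh) hneg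
  exact mem_box.mpr fun i => ⟨(mem_box.mp hv i).1, (mem_box.mp hv i).2.trans (min_le_left _ _)⟩

/-- ★ **… hence K0ᴬ BY NAME through the junction body** (✓`record13SepCoPHInhabitedAx_of_cofinalBetaSocketAxBody` ∘ §5) — recorded so the junction-through-the-JOIN edition sits on the K0ᴬ
edge too (it asks MORE than §2′: the two letters).  CONDITIONAL; K0ᴬ OPEN; the Yang–Mills mass gap is NOT proved. [cite: Balaban1987RG1, Thm 1 p.259, Thm 3 p.264 (bookkeeping)] -/
theorem record13SepCoPHInhabitedAx_of_sig8LR4Box_antecedents_orb_hess_negPart (Tok : T4Family → ℕ → ℝ → Prop)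
    (hBr : ∀ (F : T4Family) (Mc : ℕ) (a₀ : ℝ), Tok F Mc a₀ → TokP9L4Old F Mc a₀)
    (h8 : ∀ F, Sig8LR4Box F) (hA : ∀ F, JoinAntecedentsCofinal Tok F)
    (hOrb : ∀ (F : T4Family) (Mc : ℕ) (a₀ ε₂₉ : ℝ), McGuard F Mc → 0 < a₀ → 0 < ε₂₉ →
      letI θ := thetaFill F a₀ ε₂₉; letI := θ.instVβ₁; letI := θ.instVβ₂; letI := θ.instιβ;
      (∀ (k n : ℕ) (a : θ.ιβ) (l : RespLabel F k (recordK₀ F Mc k + n)), RootedResponseOrbitAt F θ k (recordK₀ F Mc k + n) a l))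
    (hHess : ∀ (F : T4Family) (a₀ ε₂₉ γ₀ : ℝ), 0 < a₀ → 0 < ε₂₉ → 0 < γ₀ → γ₀ ≤ 1 / 2 →
      letI θ := thetaFill F a₀ ε₂₉; letI := θ.instVβ₁; letI := θ.instVβ₂; letI := θ.instιβ;
      (∀ k K : ℕ, ContinuousOn (fun v : Fin (k + 1) → ℝ => fderiv ℝ (fderiv ℝ (B12PolarizationTensor120.expChart (recordTermsAx F a₀ ε₂₉ k v K) θ.ρ8)) 0) (FlowStep.Box γ₀ k)))
    (hNeg : ∀ (F : T4Family) (a₀ ε₂₉ γ₀ : ℝ), 0 < a₀ → 0 < ε₂₉ → 0 < γ₀ → γ₀ ≤ 1 / 2 →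
      ∃ e : ℕ → ℝ, RecordPlimMomentNegPartOnBoxAx F a₀ ε₂₉ γ₀ e) :
    Summit.QuantumFields.YangMills.Theses.BalabanUVNodes.Record13SepCoPHInhabitedAx :=
  record13SepCoPHInhabitedAx_of_cofinalBetaSocketAxBody
    (cofinalBetaSocketAxBody_allRadii_of_sig8LR4Box_antecedents_orb_hess_negPart Tok hBr h8 hA hOrb hHess hNeg)

-- standard axioms only
#print axioms record13SepCoPHInhabitedAx_of_sig8LR4Box_antecedents_orbit
#print axioms record13SepCoPHInhabitedAx_of_sig8LR4Box_antecedents_orb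
#print axioms cofinalBetaSocketAxBody_allRadii_of_D1Box_orbit_hessBox_negPart_cofinalRadii
#print axioms record13SepCoPHInhabitedAx_of_sig8LR4Box_antecedents_orb_hess_negPart

end Summit.QuantumFields.YangMills.Theorems.K0AxChartRowsOfOrbit

end
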